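import Mathlib
import HarnessLib
import Literature.Computability.AlgebraicComplexity.FlatteningRank
import Literature.Barriers.MatrixMultiplication.IrreversibilityBarrierThm19
import Summits.MatrixMultiplication.MatrixMultiplication.Theses.OutsiderSandwich
import Summits.MatrixMultiplication.MatrixMultiplication.Theorems.OutsiderSandwichLaserFloorCut
import Summits.MatrixMultiplication.MatrixMultiplication.Theorems.OutsiderSandwichLaserTangency

/-!
# OutsiderSandwich — the laser floor, part 3/3: necessity, the ω-free letter of attainment, the items

(decomp-mm lens-4, gen 11; parts 1–2: `OutsiderSandwichLaserFloor`, `OutsiderSandwichLaserFloorCut`.)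

* §5 `attained_of_summit` — `ω = 2 ⟹ LaserFloorAttained`: the gauge point `ζ₁` (flattening rank) is a
  universal spectral point at `(τ, x) = (2, log₂3)`, which is on the chord when `ω = 2`;
* §8 `strict_of_summit`, `summit_iff_laserFloor` — `ω = 2 ⟹ LaserTangency ⟹ LaserFloorStrict`, hence the
  transported cut is exact: `ω = 2 ⟺ LaserFloorStrict ∧ LaserFloorAttained`;
* §9 `exists_top_point` (duality WITH attainment: some universal `G` has `τ_G = ω`),
  `tightAtTop_of_attained`, `attained_of_tightAtTop` — `LaserTightAtTop` («some δ-maximal point on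
  `⟨2,2,2⟩` is δ-laser-tight»; `ω` enters only as `max_G τ_G`) is equivalent to the chord form;
  `laserMergeOptimal_of_tightAtTop`, `tightAtTop_of_summit`, `summit_iff_laserFloor'`:
  `ω = 2 ⟺ LaserFloorStrict ∧ LaserTightAtTop`;
* §10 route items (route rev 14) by name: `SummitIffLaserFloor` (33325) by `summitIffLaserFloor_holds`,
  `LaserFloorTransport` (33326) = `(LaserTangency → LaserFloorStrict) ∧ (LaserTightAtTop → LaserMergeOptimal)`
  by `laserFloorTransport_holds`.  (`LaserFloor`, 33322, is `laserFloor_holds` in part 1.)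

Geometry (paper gloss): the chord joins the gauge corner `(2, log₂3)` to the top corner
`(ω, log₂3 + (ω−2)/3)` and lies strictly below the floor for `τ < ω` (gap `(log₂3 − 2/3)(1 − τ/ω)`), so a
near-chord point is near the top corner and conversely.  All sorry-free.
-/

set_option linter.dupNamespace false

namespace Summit.MatrixMultiplication.MatrixMultiplication.Theorems.OutsiderSandwichLaserFloorTop

open scoped BigOperators Topology
open Filter
open Literature.Computability.AlgebraicComplexity
open Literature.Barriers.MatrixMultiplication (logb_two_mul_log_le_log IsAdequate flatteningRank_cwTensor)
open Summit.MatrixMultiplication.MatrixMultiplication.Theses.OutsiderSandwich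
  (LaserMergeOptimal LaserTangency PerfectAtLaser)
open Summit.MatrixMultiplication.MatrixMultiplication.Theorems.OutsiderSandwichLaserTangency
  (laserTangency_of_summit)
open Summit.MatrixMultiplication.MatrixMultiplication.Theorems.OutsiderSandwichLaserFloor
open Summit.MatrixMultiplication.MatrixMultiplication.Theorems.OutsiderSandwichLaserFloorCut

variable {F : SpectralMap ℂ}

/-! ## 5. `ω = 2 ⟹ LaserFloorAttained` (the gauge point `ζ₁` sits at `(τ, F(cw₂)) = (2, 3)`) -/

/-- Under `ω = 2` the chord is touched: the first gauge point `ζ₁ = flattening rank` has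
`ζ₁(cw₂) = 3`, `ζ₁(⟨2,2,2⟩) = 4`, so `log₂ 3 ≤ (1/3 + (log₂3 − 2/3)/2 + δ) · 2`. -/
theorem attained_of_summit (hS : _root_.MatrixMultiplication) :
    ∀ δ : ℝ, 0 < δ → ∃ F : SpectralMap ℂ, IsUniversalSpectralPoint ℂ F ∧
      Real.logb 2 (F (cwTensor ℂ 2)) ≤
        (1 / 3 + (Real.logb 2 3 - 2 / 3) / omega ℂ + δ) * Real.logb 2 (F (matMulTensor ℂ 2 2 2)) := by
  intro δ hδ
  have hω : omega ℂ = 2 := (_root_.MatrixMultiplication_iff).1 hS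
  have hG := gaugePoint₁_isUniversalSpectralPoint ℂ
  refine ⟨gaugePoint₁ ℂ, hG, ?_⟩
  have hcw : gaugePoint₁ ℂ (cwTensor ℂ 2) = 3 := by
    rw [gaugePoint₁_eq, flatteningRank_cwTensor (by norm_num : 1 ≤ 2)]
    norm_num
  have hmm : gaugePoint₁ ℂ (matMulTensor ℂ 2 2 2) = 4 := by
    have h := hG.map_kronecker (unitTensor ℂ 1) (matMulTensor ℂ 2 2 2)
    rw [hG.map_unitTensor_one, one_mul, gaugePoint₁_eq,
      flatteningRank_multiple_matMulTensor 1 2 2 2 (by norm_num)] at h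
    rw [← h]; norm_num
  rw [hcw, hmm, hω, show (4 : ℝ) = (2 : ℝ) ^ (2 : ℝ) by norm_num,
    Real.logb_rpow two_pos (by norm_num)]
  linarith

/-! ## 8. Necessity of `LaserFloorStrict`; the exact transported cut -/

/-- `ω = 2 ⟹ LaserFloorStrict` (non-vacuously: via `ω = 2 ⟹ LaserTangency`, g10). -/
theorem strict_of_summit (hS : _root_.MatrixMultiplication) :
    ∀ η : ℝ, 0 < η → ∃ δ : ℝ, 0 < δ ∧ ∀ F : SpectralMap ℂ, IsUniversalSpectralPoint ℂ F →
      2 + η ≤ Real.logb 2 (F (matMulTensor ℂ 2 2 2)) →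
        Real.logb 2 3 + (Real.logb 2 (F (matMulTensor ℂ 2 2 2)) - 2) / 3 + δ ≤
          Real.logb 2 (F (cwTensor ℂ 2)) :=
  strict_of_laserTangency (laserTangency_of_summit hS)

/-- **The transported cut is exact**: `ω = 2 ⟺ LaserFloorStrict ∧ LaserFloorAttained`. -/
theorem summit_iff_laserFloor :
    _root_.MatrixMultiplication ↔
      ((∀ η : ℝ, 0 < η → ∃ δ : ℝ, 0 < δ ∧ ∀ F : SpectralMap ℂ, IsUniversalSpectralPoint ℂ F →
        2 + η ≤ Real.logb 2 (F (matMulTensor ℂ 2 2 2)) →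
          Real.logb 2 3 + (Real.logb 2 (F (matMulTensor ℂ 2 2 2)) - 2) / 3 + δ ≤
            Real.logb 2 (F (cwTensor ℂ 2))) ∧
      (∀ δ : ℝ, 0 < δ → ∃ F : SpectralMap ℂ, IsUniversalSpectralPoint ℂ F ∧
        Real.logb 2 (F (cwTensor ℂ 2)) ≤
          (1 / 3 + (Real.logb 2 3 - 2 / 3) / omega ℂ + δ) * Real.logb 2 (F (matMulTensor ℂ 2 2 2)))) :=
  ⟨fun hS => ⟨strict_of_summit hS, attained_of_summit hS⟩, fun h => summit_of_laserFloor h.1 h.2⟩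

/-! ## 9. The ω-free reading of attainment: a near-top spectral point is laser-tight

`LaserTightAtTop`: for every `δ > 0` some universal spectral point `F` is `δ`-MAXIMAL on `⟨2,2,2⟩`
(`τ_G ≤ τ_F + δ` for every universal `G`; by Strassen duality with attainment `max_G τ_G = ω`,
tree `strassen_duality_asymptoticRank_holds`) and `δ`-TIGHT on the laser floor,
`log₂ F(cw₂) ≤ log₂3 + (τ_F − 2)/3 + δ`.  Kernel: `LaserTightAtTop ⟺ LaserFloorAttained` — in the
`(τ, x) = (log₂F⟨2,2,2⟩, log₂F(cw₂))` plane the chord from the gauge corner `(2, log₂3)` to the top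
corner `(ω, log₂3 + (ω−2)/3)` lies strictly BELOW the floor line except at `τ = ω`, so a spectral
point near the chord is forced to the top corner, and conversely. -/

/-- A universal spectral point maximal on `⟨2,2,2⟩`: `τ_G = ω` (Strassen duality, attained). -/
theorem exists_top_point :
    ∃ G : SpectralMap ℂ, IsUniversalSpectralPoint ℂ G ∧
      Real.logb 2 (G (matMulTensor ℂ 2 2 2)) = omega ℂ := by
  obtain ⟨G, hG, hGt⟩ := (strassen_duality_asymptoticRank_holds ℂ (matMulTensor ℂ 2 2 2)).2
  rw [asymptoticRank_matMulTensor ℂ 2 (by norm_num)] at hGt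
  push_cast at hGt
  refine ⟨G, hG, ?_⟩
  rw [hGt]; exact Real.logb_rpow two_pos (by norm_num)

/-- `LaserFloorAttained ⟹ LaserTightAtTop`. -/
theorem tightAtTop_of_attained
    (hA : ∀ δ : ℝ, 0 < δ → ∃ F : SpectralMap ℂ, IsUniversalSpectralPoint ℂ F ∧
        Real.logb 2 (F (cwTensor ℂ 2)) ≤
          (1 / 3 + (Real.logb 2 3 - 2 / 3) / omega ℂ + δ) * Real.logb 2 (F (matMulTensor ℂ 2 2 2))) :
    ∀ δ : ℝ, 0 < δ → ∃ F : SpectralMap ℂ, IsUniversalSpectralPoint ℂ F ∧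
        (∀ G : SpectralMap ℂ, IsUniversalSpectralPoint ℂ G →
          Real.logb 2 (G (matMulTensor ℂ 2 2 2)) ≤ Real.logb 2 (F (matMulTensor ℂ 2 2 2)) + δ) ∧
        Real.logb 2 (F (cwTensor ℂ 2)) ≤
          Real.logb 2 3 + (Real.logb 2 (F (matMulTensor ℂ 2 2 2)) - 2) / 3 + δ := by
  intro δ hδ
  have hω2 : 2 ≤ omega ℂ := omega_two_le ℂ
  have hω3 : omega ℂ ≤ 3 := omega_le_three' ℂ
  have hbL0 : 0 < Real.logb 2 3 - 2 / 3 := logb_two_three_sub_pos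
  have hω0 : 0 < omega ℂ := by linarith
  obtain ⟨b, hb⟩ : ∃ t : ℝ, t = Real.logb 2 3 - 2 / 3 := ⟨_, rfl⟩
  rw [← hb] at hbL0
  obtain ⟨u, hu⟩ : ∃ t : ℝ, t = b / omega ℂ := ⟨_, rfl⟩
  have hu0 : 0 < u := by rw [hu]; exact div_pos hbL0 hω0
  have huω : u * omega ℂ = b := by rw [hu]; exact div_mul_cancel₀ _ hω0.ne'
  have hu3 : b ≤ 3 * u := by
    have := mul_le_mul_of_nonneg_left hω3 hu0.le
    linarith
  obtain ⟨δ₁, hδ₁⟩ : ∃ t : ℝ, t = min (δ / 3) (δ * b / 9) := ⟨_, rfl⟩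
  have hδ₁0 : 0 < δ₁ := by
    rw [hδ₁]
    refine lt_min (by linarith) ?_
    have := mul_pos hδ hbL0
    linarith
  have hδ₁1 : δ₁ ≤ δ / 3 := by rw [hδ₁]; exact min_le_left _ _
  have hδ₁2 : δ₁ ≤ δ * b / 9 := by rw [hδ₁]; exact min_le_right _ _
  obtain ⟨F, hF, hFle⟩ := hA δ₁ hδ₁0
  rw [← hb, ← hu] at hFle
  have hτω := matExp_le_omega hF
  have hτ2 := two_le_matExp hF
  have hfloor := laserFloor hF
  obtain ⟨τ, hτ⟩ : ∃ t : ℝ, t = Real.logb 2 (F (matMulTensor ℂ 2 2 2)) := ⟨_, rfl⟩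
  obtain ⟨x, hx⟩ : ∃ t : ℝ, t = Real.logb 2 (F (cwTensor ℂ 2)) := ⟨_, rfl⟩
  rw [← hτ, ← hx] at hFle hfloor
  rw [← hτ] at hτω hτ2
  have hτ3 : τ ≤ 3 := by linarith
  have hδ₁τ : δ₁ * τ ≤ 3 * δ₁ := by
    have := mul_le_mul_of_nonneg_left hτ3 hδ₁0.le
    linarith
  have huτ : u * τ ≤ u * omega ℂ := mul_le_mul_of_nonneg_left hτω hu0.le
  -- floor ≤ chord + δ₁ τ forces `u (ω − τ) ≤ 3 δ₁`
  have key : u * omega ℂ - u * τ ≤ 3 * δ₁ := by linarith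
  refine ⟨F, hF, ?_, ?_⟩
  · intro G hG
    have hG' := matExp_le_omega hG
    rw [← hτ]
    have h1 : b / 3 * (omega ℂ - τ) ≤ u * (omega ℂ - τ) :=
      mul_le_mul_of_nonneg_right (by linarith) (by linarith)
    have h2 : b * (omega ℂ - τ) ≤ b * δ := by linarith
    have h3 : omega ℂ - τ ≤ δ := le_of_mul_le_mul_left h2 hbL0
    linarith
  · rw [← hτ, ← hx]
    linarith

/-- `LaserTightAtTop ⟹ LaserFloorAttained`. -/
theorem attained_of_tightAtTop
    (hT : ∀ δ : ℝ, 0 < δ → ∃ F : SpectralMap ℂ, IsUniversalSpectralPoint ℂ F ∧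
        (∀ G : SpectralMap ℂ, IsUniversalSpectralPoint ℂ G →
          Real.logb 2 (G (matMulTensor ℂ 2 2 2)) ≤ Real.logb 2 (F (matMulTensor ℂ 2 2 2)) + δ) ∧
        Real.logb 2 (F (cwTensor ℂ 2)) ≤
          Real.logb 2 3 + (Real.logb 2 (F (matMulTensor ℂ 2 2 2)) - 2) / 3 + δ) :
    ∀ δ : ℝ, 0 < δ → ∃ F : SpectralMap ℂ, IsUniversalSpectralPoint ℂ F ∧
        Real.logb 2 (F (cwTensor ℂ 2)) ≤
          (1 / 3 + (Real.logb 2 3 - 2 / 3) / omega ℂ + δ) * Real.logb 2 (F (matMulTensor ℂ 2 2 2)) := by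
  intro δ hδ
  have hω2 : 2 ≤ omega ℂ := omega_two_le ℂ
  have hbL0 : 0 < Real.logb 2 3 - 2 / 3 := logb_two_three_sub_pos
  have hω0 : 0 < omega ℂ := by linarith
  obtain ⟨b, hb⟩ : ∃ t : ℝ, t = Real.logb 2 3 - 2 / 3 := ⟨_, rfl⟩
  rw [← hb] at hbL0
  obtain ⟨u, hu⟩ : ∃ t : ℝ, t = b / omega ℂ := ⟨_, rfl⟩
  have hu0 : 0 < u := by rw [hu]; exact div_pos hbL0 hω0
  have huω : u * omega ℂ = b := by rw [hu]; exact div_mul_cancel₀ _ hω0.ne'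
  have hub : u ≤ b := by
    have := mul_le_mul_of_nonneg_left hω2 hu0.le
    linarith
  have h1b : 0 < 1 + b := by linarith
  obtain ⟨δ₂, hδ₂⟩ : ∃ t : ℝ, t = δ / (1 + b) := ⟨_, rfl⟩
  have hδ₂0 : 0 < δ₂ := by rw [hδ₂]; exact div_pos hδ h1b
  have hδ₂e : δ₂ * (1 + b) = δ := by rw [hδ₂]; exact div_mul_cancel₀ _ h1b.ne'
  obtain ⟨F, hF, htop, htight⟩ := hT δ₂ hδ₂0
  obtain ⟨G, hG, hGω⟩ := exists_top_point
  have hωτ := htop G hG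
  rw [hGω] at hωτ
  refine ⟨F, hF, ?_⟩
  rw [← hb, ← hu]
  have hτ2 := two_le_matExp hF
  obtain ⟨τ, hτ⟩ : ∃ t : ℝ, t = Real.logb 2 (F (matMulTensor ℂ 2 2 2)) := ⟨_, rfl⟩
  obtain ⟨x, hx⟩ : ∃ t : ℝ, t = Real.logb 2 (F (cwTensor ℂ 2)) := ⟨_, rfl⟩
  rw [← hτ, ← hx] at htight ⊢
  rw [← hτ] at hωτ hτ2
  have k1 : u * (omega ℂ - τ) ≤ u * δ₂ :=
    mul_le_mul_of_nonneg_left (by linarith) hu0.le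
  have k2 : δ * 2 ≤ δ * τ := mul_le_mul_of_nonneg_left hτ2 hδ.le
  have k3 : u * δ₂ ≤ b * δ₂ := mul_le_mul_of_nonneg_right hub hδ₂0.le
  linarith

/-- `LaserTightAtTop ⟹ LaserMergeOptimal` (the edge filed on the route). -/
theorem laserMergeOptimal_of_tightAtTop
    (hT : ∀ δ : ℝ, 0 < δ → ∃ F : SpectralMap ℂ, IsUniversalSpectralPoint ℂ F ∧
        (∀ G : SpectralMap ℂ, IsUniversalSpectralPoint ℂ G →
          Real.logb 2 (G (matMulTensor ℂ 2 2 2)) ≤ Real.logb 2 (F (matMulTensor ℂ 2 2 2)) + δ) ∧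
        Real.logb 2 (F (cwTensor ℂ 2)) ≤
          Real.logb 2 3 + (Real.logb 2 (F (matMulTensor ℂ 2 2 2)) - 2) / 3 + δ) :
    LaserMergeOptimal :=
  laserMergeOptimal_of_attained (attained_of_tightAtTop hT)

/-- `ω = 2 ⟹ LaserTightAtTop` (the gauge point is top AND laser-tight when `ω = 2`). -/
theorem tightAtTop_of_summit (hS : _root_.MatrixMultiplication) :
    ∀ δ : ℝ, 0 < δ → ∃ F : SpectralMap ℂ, IsUniversalSpectralPoint ℂ F ∧
        (∀ G : SpectralMap ℂ, IsUniversalSpectralPoint ℂ G →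
          Real.logb 2 (G (matMulTensor ℂ 2 2 2)) ≤ Real.logb 2 (F (matMulTensor ℂ 2 2 2)) + δ) ∧
        Real.logb 2 (F (cwTensor ℂ 2)) ≤
          Real.logb 2 3 + (Real.logb 2 (F (matMulTensor ℂ 2 2 2)) - 2) / 3 + δ :=
  tightAtTop_of_attained (attained_of_summit hS)

/-- **The ω-free cut.**  `ω(ℂ) = 2 ⟺ LaserFloorStrict ∧ LaserTightAtTop`. -/
theorem summit_iff_laserFloor' :
    _root_.MatrixMultiplication ↔
      ((∀ η : ℝ, 0 < η → ∃ δ : ℝ, 0 < δ ∧ ∀ F : SpectralMap ℂ, IsUniversalSpectralPoint ℂ F →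
        2 + η ≤ Real.logb 2 (F (matMulTensor ℂ 2 2 2)) →
          Real.logb 2 3 + (Real.logb 2 (F (matMulTensor ℂ 2 2 2)) - 2) / 3 + δ ≤
            Real.logb 2 (F (cwTensor ℂ 2))) ∧
      (∀ δ : ℝ, 0 < δ → ∃ F : SpectralMap ℂ, IsUniversalSpectralPoint ℂ F ∧
        (∀ G : SpectralMap ℂ, IsUniversalSpectralPoint ℂ G →
          Real.logb 2 (G (matMulTensor ℂ 2 2 2)) ≤ Real.logb 2 (F (matMulTensor ℂ 2 2 2)) + δ) ∧
        Real.logb 2 (F (cwTensor ℂ 2)) ≤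
          Real.logb 2 3 + (Real.logb 2 (F (matMulTensor ℂ 2 2 2)) - 2) / 3 + δ)) :=
  ⟨fun hS => ⟨(summit_iff_laserFloor.1 hS).1, tightAtTop_of_summit hS⟩,
    fun h => summit_iff_laserFloor.2 ⟨h.1, attained_of_tightAtTop h.2⟩⟩

/-! ## 10. The route items by name (route rev 14: asides 33325, 33326) -/

/-- Item `LaserFloorTransport` (stmt-MatrixMultiplication-33326) holds:
`(LaserTangency → LaserFloorStrict) ∧ (LaserTightAtTop → LaserMergeOptimal)`. -/
theorem laserFloorTransport_holds :
    Summit.MatrixMultiplication.MatrixMultiplication.Theses.OutsiderSandwich.LaserFloorTransport :=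
  And.intro strict_of_laserTangency laserMergeOptimal_of_tightAtTop

/-- Item `SummitIffLaserFloor` (stmt-MatrixMultiplication-33325) holds:
`ω(ℂ) = 2 ⟺ LaserFloorStrict ∧ LaserTightAtTop`. -/
theorem summitIffLaserFloor_holds :
    Summit.MatrixMultiplication.MatrixMultiplication.Theses.OutsiderSandwich.SummitIffLaserFloor :=
  summit_iff_laserFloor'

end Summit.MatrixMultiplication.MatrixMultiplication.Theorems.OutsiderSandwichLaserFloorTop
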